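import Summits.CriticalPhenomena.PercolationContinuityZ3.Theorems.PercFiniteBoxLROLinearScaleLROOfThetaShellCorners
import HarnessLib

/-!
# `PercFiniteBoxLRO.LinearScaleLROOfTheta` (stmt-CriticalPhenomena-0855): Cerf's missing estimate
# follows from "FEWER THAN EIGHT CROSSING CLUSTERS with positive probability" for shells of any
# fixed aspect ratio at `p_c(ℤ³)`

Helper file (`--supports stmt-CriticalPhenomena-0855`) of line `registered` (lead c1); the weakest
form of the shell reduction landed in `…ShellUniq.lean` / `…ShellUniqAspect.lean`.  Notation:
`P = P_{p_c}` bond percolation on `ℤ³`, `Λ_m = box 3 m`, `∂ⁱⁿΛ_m` the sphere `‖x‖_∞ = m`; for an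
integer aspect ratio `l ≥ 2` and `k ∈ ℕ` the shell `A = Λ_{l(k+1)} ∖ Λ_k`.  The event `F⁸_{l,k}`
("fewer than eight crossing clusters"): there are NO eight sites of `∂ⁱⁿΛ_{k+1}`, each joined inside
`A` to `∂ⁱⁿΛ_{l(k+1)}`, pairwise not joined inside `A`.

**Theorem** (`linearScaleLROOfTheta_of_shellFewPos_aspect`).  If for SOME `l ≥ 2` and `δ > 0`,
`P_{p_c}(F⁸_{l,k}) ≥ δ` for all large `k`, then `LinearScaleLROOfTheta` (Cerf 2015, p. 4).

Proof (`criticalFloor_of_shellFewPos_aspect`).  Let `θ := θ(p_c) > 0` and suppose that at scale `n`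
EVERY `x ∈ ∂ⁱⁿΛ_n` has `P(0 ↔ x inside Λ_{Kn}) < ρ₀ := θ⁸/112`.  The eight corners `c_s = n·s`,
`s ∈ {0,1}³`, of the cube `[0,n]³` differ pairwise by vectors of `∂ⁱⁿΛ_n`, so by translation
invariance every two of them are joined inside `Λ_{(K-1)n}` with probability `< ρ₀`; by Harris–FKG all
eight percolate with probability `≥ θ⁸`; hence with probability `≥ θ⁸ - 56ρ₀ = θ⁸/2` all eight
percolate and no two are joined inside `Λ_{(K-1)n}`.  On that event the arms of the eight corners
split every shell `Λ_{l m_j} ∖ Λ_{m_j-1}`, `m_j = (2l)^{j+1} n`, `j < J`, into at least eight crossing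
clusters (`ShellUniq.shell_segment_gen`), i.e. `F⁸` FAILS in `J` pairwise disjoint shells; these
failures are independent, so `θ⁸/2 ≤ (1-δ)^J` — absurd for `J` large.  Small scales by AKN pointwise
local uniqueness and Cerf's Lemma 10.1; then the landed `linearScaleLROOfTheta_of_criticalFloor`.

The hypothesis is a θ-free thinness statement of hyperscaling type — "annulus-spanning clusters do
not proliferate", in its weakest positive-probability, bounded-aspect form (cf. route
`PercNonProliferation`, crux 4444, and Aizenman 1997: for `d > 6` there ARE `≍ n^{d-6}` spanning
clusters, so it fails there).  It is OPEN; nothing here claims it.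

## References

* R. Cerf, Ann. Probab. 43 (2015) 2458–2480, arXiv:1306.3105, p. 4 and §10 [Cerf2015].
* M. Aizenman, Nucl. Phys. B 485 (1997) 551–582 [Aizenman1997].
* G. Grimmett, *Percolation*, 2nd ed. (1999), Thm (2.4), §2.2, §1.6 [GrimmettPercolation1999].
-/

noncomputable section

namespace Summit.CriticalPhenomena.PercolationContinuityZ3.Theorems

namespace ShellUniq

open Literature.Probability.Percolation Literature.Probability.LatticeModels
open Literature.Probability.Percolation.DCT16 Literature.Probability.Percolation.AKN
open MeasureTheory Filter Set
open scoped Topology ENNReal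

/-! ## The reduction -/

/-- **"Fewer than eight crossing clusters" with positive probability ⟹ the critical one-site
floor.**  If for some `l ≥ 2`, `δ > 0` and all `k ≥ k₀`, with `P_{p_c}`-probability `≥ δ` the shell
`Λ_{l(k+1)} ∖ Λ_k` does NOT contain eight sites of `∂ⁱⁿΛ_{k+1}`, each joined inside the shell to
`∂ⁱⁿΛ_{l(k+1)}`, pairwise not joined inside the shell, then `θ(p_c) > 0` implies: for some
`ρ₀ > 0`, `K ≥ 1` and every `n ≥ 1`, some `x ∈ ∂ⁱⁿΛ_n` has `P_{p_c}(0 ↔ x inside Λ_{Kn}) ≥ ρ₀`.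
[cite: Cerf2015, p. 4 and §10] -/
theorem criticalFloor_of_shellFewPos_aspect
    (hU : ∃ l : ℕ, 2 ≤ l ∧ ∃ δ : ℝ, 0 < δ ∧ ∃ k₀ : ℕ, ∀ k : ℕ, k₀ ≤ k →
      δ ≤ (bondPercolation (zdGraph 3) (criticalProbI 3)).real {ω : BondConfig (Site 3) |
        ¬ ∃ x : Fin 8 → Site 3, (∀ i, x i ∈ innerBoundary (zdGraph 3) (box 3 (k + 1))) ∧
          (∀ i, ∃ b ∈ innerBoundary (zdGraph 3) (box 3 (l * (k + 1))),
            ω ∈ openConnIn (↑(box 3 (l * (k + 1)) \ box 3 k) : Set (Site 3)) (x i) b) ∧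
          ∀ i j, i ≠ j → ω ∉ openConnIn (↑(box 3 (l * (k + 1)) \ box 3 k) : Set (Site 3)) (x i) (x j)})
    (hθ : 0 < theta (zdGraph 3) (0 : Site 3) (criticalProbI 3)) :
    ∃ ρ₀ : ℝ, 0 < ρ₀ ∧ ∃ K : ℕ, 1 ≤ K ∧ ∀ n : ℕ, 1 ≤ n →
      ∃ x ∈ innerBoundary (zdGraph 3) (box 3 n),
        ρ₀ ≤ (bondPercolation (zdGraph 3) (criticalProbI 3)).real
          (openConnIn (↑(box 3 (K * n)) : Set (Site 3)) (0 : Site 3) x) := by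
  classical
  set p : unitInterval := criticalProbI 3 with hp
  set μ := bondPercolation (zdGraph 3) p with hμ
  set θ₀ : ℝ := theta (zdGraph 3) (0 : Site 3) p with hθ₀
  obtain ⟨l, hl, δ, hδ, k₀, hk₀⟩ := hU
  -- the "fewer than eight crossing clusters" events at aspect ratio `l`, as a family
  set U : ℕ → Set (BondConfig (Site 3)) := fun k => {ω : BondConfig (Site 3) |
        ¬ ∃ x : Fin 8 → Site 3, (∀ i, x i ∈ innerBoundary (zdGraph 3) (box 3 (k + 1))) ∧
          (∀ i, ∃ b ∈ innerBoundary (zdGraph 3) (box 3 (l * (k + 1))),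
            ω ∈ openConnIn (↑(box 3 (l * (k + 1)) \ box 3 k) : Set (Site 3)) (x i) b) ∧
          ∀ i j, i ≠ j → ω ∉ openConnIn (↑(box 3 (l * (k + 1)) \ box 3 k) : Set (Site 3)) (x i) (x j)}
    with hUdef
  have hUk : ∀ k, k₀ ≤ k → δ ≤ μ.real (U k) := fun k hk => hk₀ k hk
  have hθ1 : θ₀ ≤ 1 := measureReal_le_one
  have hθ8 : 0 < θ₀ ^ 8 := by positivity
  have hδ1 : δ ≤ 1 := (hUk k₀ le_rfl).trans measureReal_le_one
  obtain ⟨J, hJ⟩ := exists_pow_lt_of_lt_one (show 0 < θ₀ ^ 8 / 2 by positivity)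
    (show 1 - δ < 1 by linarith)
  -- small scales: AKN pointwise local uniqueness at the axis sites
  set ε : ℝ≥0∞ := ENNReal.ofReal (θ₀ ^ 2 / 4) with hε
  have hεpos : 0 < ε := by rw [hε, ENNReal.ofReal_pos]; positivity
  have hev : ∀ n ∈ Finset.range (k₀ + 1), ∀ᶠ j : ℕ in atTop,
      μ (badPair (n + j) (0 : Site 3) (Pi.single 0 (n : ℤ))) < ε := fun n _ =>
    (tendsto_measure_badPair p (zero_mem_box 3 n) (LinearScaleLROReduction.single_mem_box n)).eventually
      (gt_mem_nhds hεpos)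
  obtain ⟨j₀, hj₀⟩ := ((Finset.eventually_all (Finset.range (k₀ + 1))).2 hev).exists_forall_of_atTop
  -- the box factor: the shells live in `Λ_{(K-1)n}`, one unit of `n` is spent on translations
  set K : ℕ := max (l * (2 * l) ^ J + 1) (j₀ + 1) with hK
  have hK1 : 1 ≤ K := le_trans (by omega) (le_max_right _ _)
  have hKJ : l * (2 * l) ^ J + 1 ≤ K := le_max_left _ _
  have hKj : j₀ + 1 ≤ K := le_max_right _ _
  have hlpos : 1 ≤ l * (2 * l) ^ J := Nat.one_le_iff_ne_zero.2 (Nat.mul_ne_zero (by omega) (by positivity))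
  refine ⟨θ₀ ^ 8 / 112, by positivity, K, hK1, fun n hn => ?_⟩
  by_contra hcon
  push Not at hcon
  -- `hcon : ∀ x ∈ ∂ⁱⁿΛ_n, P(0 ↔ x inside Λ_{Kn}) < θ₀⁸/112`
  set v : Site 3 := Pi.single 0 (n : ℤ) with hv
  have hlt := hcon v (LinearScaleLROReduction.single_mem_innerBoundary n)
  rcases lt_or_ge n (k₀ + 1) with hsmall | hlarge
  · -- small scale `n ≤ k₀`
    obtain ⟨j, hj⟩ : ∃ j, K * n = n + j := Nat.exists_eq_add_of_le (Nat.le_mul_of_pos_left n (by omega))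
    have h1 : (j₀ + 1) * n ≤ K * n := Nat.mul_le_mul_right n hKj
    rw [add_mul, one_mul] at h1
    have h2 : j₀ ≤ j₀ * n := Nat.le_mul_of_pos_right j₀ (by omega)
    have hjge : j₀ ≤ j := by omega
    have hlt' := hj₀ j hjge n (Finset.mem_range.2 hsmall)
    have hreal : μ.real (badPair (n + j) (0 : Site 3) v) ≤ θ₀ ^ 2 / 4 := by
      rw [measureReal_def]
      have h := ENNReal.toReal_mono ENNReal.ofReal_ne_top hlt'.le
      rwa [ENNReal.toReal_ofReal (by positivity)] at h
    have hvbox : v ∈ box 3 (n + j) := box_mono 3 (by omega) (LinearScaleLROReduction.single_mem_box n)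
    have h10 := LinearScaleLROReduction.cerf_lemma_10_1 p (zero_mem_box 3 (n + j)) hvbox
    rw [hj] at hlt
    have h82 : θ₀ ^ 8 ≤ θ₀ ^ 2 := pow_le_pow_of_le_one measureReal_nonneg hθ1 (by norm_num)
    linarith
  · -- large scale: eight corners, the split event, `J` disjoint shells inside `Λ_{(K-1)n}`
    have hn1 : 1 ≤ n := hn
    set R : ℕ := (K - 1) * n with hR
    have hKR : K * n = R + n := by
      rw [hR]; obtain ⟨K', hK'⟩ : ∃ K', K = K' + 1 := ⟨K - 1, by omega⟩
      rw [hK']; simp [add_mul]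
    have hnR : n ≤ R := by
      rw [hR]; exact Nat.le_mul_of_pos_left n (by omega)
    -- the scales `m j = (2l)^{j+1} n`, inner radii `k j + 1 = m j`, outer radii `q j + 1 = l m j`
    have h2l : 1 ≤ 2 * l := by omega
    set m : ℕ → ℕ := fun j => (2 * l) ^ (j + 1) * n with hm
    have hm_succ : ∀ j, m (j + 1) = 2 * l * m j := fun j => by
      show (2 * l) ^ (j + 1 + 1) * n = 2 * l * ((2 * l) ^ (j + 1) * n)
      rw [pow_succ]; ring
    have hm_mono : ∀ i j, i ≤ j → m i ≤ m j := fun i j hij =>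
      Nat.mul_le_mul_right n (Nat.pow_le_pow_right h2l (by omega))
    have hm0 : n + 1 ≤ m 0 := by
      show n + 1 ≤ (2 * l) ^ (0 + 1) * n
      rw [zero_add, pow_one]
      nlinarith
    have hm1 : ∀ j, n + 1 ≤ m j := fun j => hm0.trans (hm_mono 0 j (Nat.zero_le j))
    set k : ℕ → ℕ := fun j => m j - 1 with hk
    have hk1 : ∀ j, k j + 1 = m j := fun j => Nat.sub_add_cancel (by have := hm1 j; omega)
    have hnk : ∀ j, n ≤ k j := fun j => by have := hm1 j; have := hk1 j; omega
    set q : ℕ → ℕ := fun j => l * m j - 1 with hq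
    have hlm1 : ∀ j, 1 ≤ l * m j := fun j =>
      Nat.one_le_iff_ne_zero.2 (Nat.mul_ne_zero (by omega) (by have := hm1 j; omega))
    have hq1 : ∀ j, q j + 1 = l * (k j + 1) := fun j => by
      rw [hk1 j]; exact Nat.sub_add_cancel (hlm1 j)
    have hkq : ∀ j, k j < q j := fun j => by
      have h1 : m j + m j ≤ l * m j := by nlinarith [hm1 j]
      have h2 := hk1 j
      have h3 : q j + 1 = l * m j := by rw [hq1 j, hk1 j]
      have h4 := hm1 j
      omega
    -- shells with `j < J` fit inside `Λ_R`
    have hfit : ∀ j, j < J → q j + 1 ≤ R := fun j hj => by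
      rw [hq1 j, hk1 j, hR]
      show l * ((2 * l) ^ (j + 1) * n) ≤ (K - 1) * n
      have h4 : (2 * l) ^ (j + 1) ≤ (2 * l) ^ J := Nat.pow_le_pow_right h2l hj
      have hK' : l * (2 * l) ^ J ≤ K - 1 := by omega
      calc l * ((2 * l) ^ (j + 1) * n) = (l * (2 * l) ^ (j + 1)) * n := by ring
        _ ≤ (l * (2 * l) ^ J) * n := Nat.mul_le_mul_right n (Nat.mul_le_mul_left l h4)
        _ ≤ (K - 1) * n := Nat.mul_le_mul_right n hK'
    -- disjointness of the shells
    set F : ℕ → Finset (Sym2 (Site 3)) := fun j => (box 3 (l * (k j + 1)) \ box 3 (k j)).sym2 with hF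
    have hshell_disj : ∀ i j, i < j → Disjoint (box 3 (l * (k i + 1)) \ box 3 (k i))
        (box 3 (l * (k j + 1)) \ box 3 (k j)) := by
      intro i j hij
      rw [Finset.disjoint_left]
      intro z hzi hzj
      rw [Finset.mem_sdiff] at hzi hzj
      apply hzj.2
      refine box_mono 3 ?_ hzi.1
      rw [hk1 i]
      have h1 : m (i + 1) ≤ m j := hm_mono (i + 1) j hij
      rw [hm_succ i] at h1
      have h2 := hlm1 i
      have h3 := hk1 j
      set t := l * m i with ht
      have h4 : 2 * l * m i = 2 * t := by rw [ht]; ring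
      rw [h4] at h1
      show t ≤ k j
      omega
    have hFdisj : ∀ i j, i < j → j < J → Disjoint (F i) (F j) := by
      intro i j hij _
      rw [Finset.disjoint_left]
      intro e hei hej
      induction e using Sym2.ind with
      | h x y =>
        rw [hF, Finset.mk_mem_sym2_iff] at hei hej
        exact Finset.disjoint_left.1 (hshell_disj i j hij) hei.1 hej.1
    -- corners and their pairwise non-connections inside `Λ_R`
    set c : (Fin 3 → Bool) → Site 3 := fun s i => if s i then (n : ℤ) else 0 with hc
    have hcbox : ∀ s, c s ∈ box 3 n := fun s => corner_mem_box n s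
    have hpair : ∀ s s', s ≠ s' →
        μ.real (openConnIn (↑(box 3 R) : Set (Site 3)) (c s) (c s')) < θ₀ ^ 8 / 112 := by
      intro s s' hss'
      refine real_openConnIn_lt_of_translate p (B := K * n) (by omega) (hcbox s)
        (box_mono 3 hnR (hcbox s)) ?_
      exact hcon _ (corner_sub_mem_innerBoundary n hss')
    -- the split event `E`: all corners percolate, no two are joined inside `Λ_R`
    set T : Finset (Site 3) := Finset.univ.image c with hT
    set Pairs : Finset ((Fin 3 → Bool) × (Fin 3 → Bool)) := Finset.univ.filter fun ss => ss.1 ≠ ss.2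
      with hPairs
    set E : Set (BondConfig (Site 3)) := (⋂ z ∈ T, percolatesAt z) \
      ⋃ ss ∈ Pairs, openConnIn (↑(box 3 R) : Set (Site 3)) (c ss.1) (c ss.2) with hE
    have hcinj : Function.Injective c := by
      intro s s' hss'
      by_contra hne
      have h : c s' - c s ∈ innerBoundary (zdGraph 3) (box 3 n) := corner_sub_mem_innerBoundary n hne
      rw [hss', sub_self] at h
      have := (mem_innerBoundary_iff.1 h).2
      obtain ⟨y, hy, hy0⟩ := this
      apply hy
      have := mem_box_succ_of_adj (zero_mem_box 3 0) hy0
      exact box_mono 3 hn1 this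
    have hTcard : T.card = 8 := by
      rw [hT, Finset.card_image_of_injective _ hcinj, Finset.card_univ, Fintype.card_fun,
        Fintype.card_bool, Fintype.card_fin]
      norm_num
    have hPcard : (Pairs.card : ℝ) ≤ 56 := by
      have : Pairs.card ≤ (Finset.univ : Finset ((Fin 3 → Bool) × (Fin 3 → Bool))).card :=
        Finset.card_filter_le _ _
      rw [Finset.card_univ, Fintype.card_prod, Fintype.card_fun, Fintype.card_bool, Fintype.card_fin] at this
      have h64 : Pairs.card ≤ 56 := by
        -- the diagonal has 8 elements
        have hdiag : (Finset.univ.filter fun ss : (Fin 3 → Bool) × (Fin 3 → Bool) => ¬ ss.1 ≠ ss.2).card = 8 := by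
          have : (Finset.univ.filter fun ss : (Fin 3 → Bool) × (Fin 3 → Bool) => ¬ ss.1 ≠ ss.2) =
              (Finset.univ : Finset (Fin 3 → Bool)).image fun s => (s, s) := by
            ext ss
            simp only [ne_eq, not_not, Finset.mem_filter, Finset.mem_univ, true_and, Finset.mem_image]
            constructor
            · intro h; exact ⟨ss.1, Prod.ext rfl h⟩
            · rintro ⟨s, rfl⟩; rfl
          rw [this, Finset.card_image_of_injective _ fun s s' h => (Prod.ext_iff.1 h).1, Finset.card_univ,
            Fintype.card_fun, Fintype.card_bool, Fintype.card_fin]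
          norm_num
        have hsum := Finset.card_filter_add_card_filter_not
          (s := (Finset.univ : Finset ((Fin 3 → Bool) × (Fin 3 → Bool)))) (fun ss => ss.1 ≠ ss.2)
        rw [Finset.card_univ, Fintype.card_prod, Fintype.card_fun, Fintype.card_bool, Fintype.card_fin,
          hdiag] at hsum
        rw [hPairs]
        omega
      exact_mod_cast h64
    have hEge : θ₀ ^ 8 / 2 ≤ μ.real E := by
      have hI : θ₀ ^ 8 ≤ μ.real (⋂ z ∈ T, percolatesAt z) := by
        have h := pow_card_le_real_biInter_percolatesAt p T
        rwa [hTcard] at h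
      have hUnion : μ.real (⋃ ss ∈ Pairs, openConnIn (↑(box 3 R) : Set (Site 3)) (c ss.1) (c ss.2)) ≤
          Pairs.card * (θ₀ ^ 8 / 112) := by
        refine (measureReal_biUnion_finset_le Pairs _).trans ?_
        have : ∀ ss ∈ Pairs, μ.real (openConnIn (↑(box 3 R) : Set (Site 3)) (c ss.1) (c ss.2)) ≤ θ₀ ^ 8 / 112 :=
          fun ss hss => (hpair ss.1 ss.2 (Finset.mem_filter.1 hss).2).le
        calc ∑ ss ∈ Pairs, μ.real (openConnIn (↑(box 3 R) : Set (Site 3)) (c ss.1) (c ss.2))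
            ≤ ∑ _ss ∈ Pairs, θ₀ ^ 8 / 112 := Finset.sum_le_sum this
          _ = Pairs.card * (θ₀ ^ 8 / 112) := by rw [Finset.sum_const, nsmul_eq_mul]
      have hdiff : μ.real (⋂ z ∈ T, percolatesAt z) ≤ μ.real E +
          μ.real (⋃ ss ∈ Pairs, openConnIn (↑(box 3 R) : Set (Site 3)) (c ss.1) (c ss.2)) := by
        refine (measureReal_mono ?_).trans (measureReal_union_le _ _)
        intro ω hω
        by_cases hc' : ω ∈ ⋃ ss ∈ Pairs, openConnIn (↑(box 3 R) : Set (Site 3)) (c ss.1) (c ss.2)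
        · exact Or.inr hc'
        · exact Or.inl ⟨hω, hc'⟩
      have hU' : μ.real (⋃ ss ∈ Pairs, openConnIn (↑(box 3 R) : Set (Site 3)) (c ss.1) (c ss.2)) ≤
          56 * (θ₀ ^ 8 / 112) :=
        hUnion.trans (mul_le_mul_of_nonneg_right hPcard (by positivity))
      linarith
    -- an enumeration of the eight corners
    have hcard8 : Fintype.card (Fin 3 → Bool) = 8 := by
      rw [Fintype.card_fun, Fintype.card_bool, Fintype.card_fin]; norm_num
    set e : Fin 8 ≃ (Fin 3 → Bool) := (Fintype.equivFinOfCardEq hcard8).symm with he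
    -- on the split event every "fewer than eight" event `U (k j)`, `j < J`, fails
    have hEsub : μ.real E ≤ μ.real (⋂ j ∈ Finset.range J, (U (k j))ᶜ) := by
      refine real_mono_of_forall_subset_edgeSet (zdGraph 3) p fun ω hω hωE => ?_
      simp only [Set.mem_iInter, Finset.mem_range]
      intro j hj
      obtain ⟨hperc, hnc⟩ := hωE
      -- arms of the corners and their shell segments
      have hpz : ∀ s, ω ∈ percolatesAt (c s) := by
        intro s
        have : ω ∈ ⋂ z ∈ T, percolatesAt z := hperc
        rw [Set.mem_iInter₂] at this
        exact this (c s) (by rw [hT]; exact Finset.mem_image_of_mem c (Finset.mem_univ s))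
      have hseg : ∀ s, ∃ a ∈ innerBoundary (zdGraph 3) (box 3 (k j + 1)),
          ∃ b ∈ innerBoundary (zdGraph 3) (box 3 (q j + 1)),
            ω ∈ openConnIn (↑(box 3 (q j + 1) \ box 3 (k j)) : Set (Site 3)) a b ∧
              ω ∈ openConnIn (↑(box 3 R) : Set (Site 3)) (c s) a := by
        intro s
        obtain ⟨w, hw, hcw⟩ := toBdry_of_percolatesAt (box_mono 3 hnR (hcbox s)) hω (hpz s)
        have hqR : q j < R := by have := hfit j hj; omega
        exact shell_segment_gen (hkq j) hω (box_mono 3 (hnk j) (hcbox s))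
          (notMem_box_of_mem_innerBoundary_box hqR hw) hcw
      choose a ha b hb hab hca using hseg
      have hnoconn : ∀ s s', s ≠ s' →
          ω ∉ openConnIn (↑(box 3 (q j + 1) \ box 3 (k j)) : Set (Site 3)) (a s) (a s') := by
        intro s s' hss' hss
        apply hnc
        rw [Set.mem_iUnion₂]
        refine ⟨(s, s'), Finset.mem_filter.2 ⟨Finset.mem_univ _, hss'⟩, ?_⟩
        have hsub : (↑(box 3 (q j + 1) \ box 3 (k j)) : Set (Site 3)) ⊆ ↑(box 3 R) := by
          rw [Finset.coe_sdiff]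
          rintro z ⟨hz, -⟩
          exact Finset.coe_subset.2 (box_mono 3 (hfit j hj)) hz
        have h1 : ω ∈ openConnIn (↑(box 3 R) : Set (Site 3)) (a s') (c s') := by
          have := hca s'
          rw [mem_openConnIn_iff_pathIn] at this ⊢
          exact this.symm
        exact openConnIn_trans' (openConnIn_trans' (hca s) (openConnIn_mono' hsub hss)) h1
      -- the witness: eight pairwise non-joined crossings
      simp only [hUdef, Set.mem_compl_iff, Set.mem_setOf_eq, not_not]
      refine ⟨fun i => a (e i), fun i => ha (e i), fun i => ?_, fun i i' hii' => ?_⟩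
      · have h := hb (e i); have h' := hab (e i)
        rw [hq1 j] at h h'
        exact ⟨b (e i), h, h'⟩
      · have h := hnoconn (e i) (e i') (fun heq => hii' (e.injective heq))
        rwa [hq1 j] at h
    -- independence: the failures have probability `≤ (1-δ)^J`
    have hdet : ∀ j, DeterminedBy (U (k j)) (↑(F j) : Set (Sym2 (Site 3))) := fun j => by
      rw [determinedBy_iff]
      intro ω ω' hωω'
      have key : ∀ x y : Site 3,
          ω ∈ openConnIn (↑(box 3 (l * (k j + 1)) \ box 3 (k j)) : Set (Site 3)) x y ↔
            ω' ∈ openConnIn (↑(box 3 (l * (k j + 1)) \ box 3 (k j)) : Set (Site 3)) x y := fun x y =>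
        (determinedBy_iff _ _).1 (determinedBy_openConnIn
          (↑(box 3 (l * (k j + 1)) \ box 3 (k j)) : Set (Site 3)) x y
          (K := (↑((box 3 (l * (k j + 1)) \ box 3 (k j)).sym2) : Set (Sym2 (Site 3))))
          (by rw [Finset.coe_sym2])) ω ω' hωω'
      simp only [hUdef, Set.mem_setOf_eq, key]
    have hpow : μ.real (⋂ j ∈ Finset.range J, (U (k j))ᶜ) ≤ (1 - δ) ^ J := by
      refine real_biInter_le_pow p (A := fun j => (U (k j))ᶜ) (F := F) (fun j => ?_) hFdisj
        (by linarith) fun j hj => ?_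
      · have h := hdet j
        rw [determinedBy_iff] at h ⊢
        intro ω ω' hωω'
        rw [Set.mem_compl_iff, Set.mem_compl_iff, h ω ω' hωω']
      · have hmeas : MeasurableSet (U (k j)) := (hdet j).measurableSet_of_finset
        rw [measureReal_compl hmeas, probReal_univ]
        have hkj : k₀ ≤ k j := by have := hnk j; omega
        linarith [hUk (k j) hkj]
    linarith

end ShellUniq

open Literature.Probability.Percolation Literature.Probability.LatticeModels MeasureTheory

/-- **"Fewer than eight crossing clusters" with positive probability, for shells of SOME fixed
aspect ratio at `p_c(ℤ³)`, implies Cerf's missing estimate `X_D`.**  Hypothesis (OPEN; θ-free,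
hyperscaling type — annulus-spanning clusters do not proliferate, in its weakest positive-probability,
bounded-aspect form): there are an integer `l ≥ 2`, `δ > 0` and `k₀` such that for every `k ≥ k₀`,
with `P_{p_c}`-probability at least `δ`, there are NO eight sites of `∂ⁱⁿΛ_{k+1}`, each joined inside
the shell `Λ_{l(k+1)} ∖ Λ_k` to `∂ⁱⁿΛ_{l(k+1)}`, pairwise not joined inside that shell.  Conclusion:
`LinearScaleLROOfTheta` (for every `p` with `θ(p) > 0`, linear-scale finite-box long-range order).
Proof: `ShellUniq.criticalFloor_of_shellFewPos_aspect` (eight cube corners, Harris–FKG, translation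
invariance, shell segments, independence of disjoint shells) and the landed
`linearScaleLROOfTheta_of_criticalFloor`. [cite: Cerf2015, p. 4 and §10] -/
theorem linearScaleLROOfTheta_of_shellFewPos_aspect :
    (∃ l : ℕ, 2 ≤ l ∧ ∃ δ : ℝ, 0 < δ ∧ ∃ k₀ : ℕ, ∀ k : ℕ, k₀ ≤ k →
      δ ≤ (bondPercolation (zdGraph 3) (criticalProbI 3)).real {ω : BondConfig (Site 3) |
        ¬ ∃ x : Fin 8 → Site 3, (∀ i, x i ∈ innerBoundary (zdGraph 3) (box 3 (k + 1))) ∧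
          (∀ i, ∃ b ∈ innerBoundary (zdGraph 3) (box 3 (l * (k + 1))),
            ω ∈ openConnIn (↑(box 3 (l * (k + 1)) \ box 3 k) : Set (Site 3)) (x i) b) ∧
          ∀ i j, i ≠ j → ω ∉ openConnIn (↑(box 3 (l * (k + 1)) \ box 3 k) : Set (Site 3)) (x i) (x j)}) →
    Summit.CriticalPhenomena.PercolationContinuityZ3.Theses.PercFiniteBoxLRO.LinearScaleLROOfTheta :=
  fun hU => linearScaleLROOfTheta_of_criticalFloor (ShellUniq.criticalFloor_of_shellFewPos_aspect hU)

end Summit.CriticalPhenomena.PercolationContinuityZ3.Theorems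

end
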